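import Mathlib.Analysis.SpecialFunctions.Exponential
import Mathlib.Analysis.SpecificLimits.Normed
import Mathlib.Analysis.Normed.Group.FunctionSeries
import Literature.Analysis.Convolution.HalfLineConvolution
import HarnessLib

/-!
# The resolvent of a continuous renewal kernel: existence (Neumann series) and the variation-of-constants formula

Topic `Literature/Analysis/Convolution`; uses the complex half-line convolution `hconv` of `HalfLineConvolution.lean`.
Everything here is PROVED (Gripenberg–Londen–Staffans 1990, Ch. 2 §3 «the resolvent»: Thm 3.1 existence of the resolvent of a
continuous kernel by the Neumann series, Thm 3.5 the variation-of-constants formula; Schiff 1999 §2.7 for the convolution algebra).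

* `exists_resolvent` — for `k` continuous with `‖k(t)‖ ≤ K` on `t ≥ 0` there is a continuous `r` with
  `r(t) = k(t) + (k ⋆ r)(t)` and `‖r(t)‖ ≤ K e^{Kt}` for `t ≥ 0` (Neumann series `Σ k^{⋆(n+1)}`, `‖k^{⋆(n+1)}(t)‖ ≤ K^{n+1}tⁿ/n!`);
* `renewal_solution_eq` — **variation of constants**: if `r` is such a resolvent and `m` is a continuous solution of the renewal
  equation `m = m₀ + k ⋆ m` on `[0,∞)`, then `m = m₀ + r ⋆ m₀` on `[0,∞)` (associativity + commutativity of `⋆`;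
  no uniqueness statement is needed or claimed).

With `RenewalResolventPole.lean` (the resolvent is `e^{t}/E′(1) + O(e^{−βt})` when the symbol has one simple zero) and the cell's
`SheetRRenewalBookkeeping` this closes the scalar renewal chain behind «linearly stable modulo gauge» (ns-blowup Z3-SR-SPEC,
memo P9-P10-RENEWAL-DESIGN v2, bricks (R-b′)). NOT here: Laplace transforms, uniqueness (Gronwall), operators, any model.
-/

noncomputable section

open _root_.MeasureTheory _root_.Set _root_.Filter _root_.Real intervalIntegral
open scoped _root_.Topology Nat

namespace Literature.Analysis.Convolution

variable {k : ℝ → ℂ}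

/-! ### Neumann iterates and their factorial bounds -/

/-- The Neumann iterates `a₀ = k`, `a_{n+1} = k ⋆ aₙ` (so `aₙ = k^{⋆(n+1)}`).
[cite: GripenbergLondenStaffans1990, Ch. 2 Thm 3.1 (Neumann series for the resolvent)] -/
def neumannTerm (k : ℝ → ℂ) : ℕ → ℝ → ℂ
  | 0 => k
  | n + 1 => hconv k (neumannTerm k n)

/-- Each Neumann iterate is continuous. [cite: GripenbergLondenStaffans1990, Ch. 2 Thm 3.1] -/
theorem continuous_neumannTerm (hk : Continuous k) : ∀ n, Continuous (neumannTerm k n)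
  | 0 => hk
  | n + 1 => continuous_hconv hk (continuous_neumannTerm hk n)

/-- **Factorial bound** `‖aₙ(t)‖ ≤ K^{n+1} tⁿ/n!` on `t ≥ 0` when `‖k‖ ≤ K` on `[0,∞)`.
[cite: GripenbergLondenStaffans1990, Ch. 2 Thm 3.1 (proof)] -/
theorem norm_neumannTerm_le {K : ℝ} (hK : ∀ t, 0 ≤ t → ‖k t‖ ≤ K) :
    ∀ (n : ℕ) (t : ℝ), 0 ≤ t → ‖neumannTerm k n t‖ ≤ K ^ (n + 1) * t ^ n / n ! := by
  have hK0 : 0 ≤ K := (norm_nonneg _).trans (hK 0 le_rfl)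
  intro n
  induction n with
  | zero =>
    intro t ht
    show ‖k t‖ ≤ _
    simpa using hK t ht
  | succ n ih =>
    intro t ht
    show ‖hconv k (neumannTerm k n) t‖ ≤ _
    rw [hconv]
    have hbound : ∀ u ∈ Set.Ioc (0 : ℝ) t, ‖k (t - u) * neumannTerm k n u‖ ≤ K * (K ^ (n + 1) * u ^ n / n !) := by
      intro u hu
      rw [norm_mul]
      exact mul_le_mul (hK _ (by linarith [hu.2])) (ih u hu.1.le) (norm_nonneg _) hK0
    have hint : IntervalIntegrable (fun u : ℝ => K * (K ^ (n + 1) * u ^ n / n !)) volume 0 t :=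
      (Continuous.continuousOn (by fun_prop)).intervalIntegrable
    refine (intervalIntegral.norm_integral_le_of_norm_le ht (Eventually.of_forall hbound) hint).trans (le_of_eq ?_)
    rw [intervalIntegral.integral_const_mul, intervalIntegral.integral_div, intervalIntegral.integral_const_mul,
      integral_pow, zero_pow (Nat.succ_ne_zero n), sub_zero, Nat.factorial_succ]
    push_cast
    field_simp
    ring

/-! ### The Neumann series on `[0, ∞)` -/

/-- The Neumann series converges uniformly on `[0, T]`; its sum is continuous on `[0, ∞)`.
[cite: GripenbergLondenStaffans1990, Ch. 2 Thm 3.1 (proof)] -/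
theorem continuousOn_tsum_neumannTerm (hk : Continuous k) {K : ℝ} (hK : ∀ t, 0 ≤ t → ‖k t‖ ≤ K) :
    ContinuousOn (fun t => ∑' n, neumannTerm k n t) (Ici 0) := by
  have hK0 : 0 ≤ K := (norm_nonneg _).trans (hK 0 le_rfl)
  have hT : ∀ T : ℝ, 0 ≤ T → ContinuousOn (fun t => ∑' n, neumannTerm k n t) (Icc 0 T) := by
    intro T hT0
    refine continuousOn_tsum (fun n => (continuous_neumannTerm hk n).continuousOn)
      ((Real.summable_pow_div_factorial (K * T)).mul_left K) fun n t ht => ?_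
    calc ‖neumannTerm k n t‖ ≤ K ^ (n + 1) * t ^ n / n ! := norm_neumannTerm_le hK n t ht.1
      _ ≤ K ^ (n + 1) * T ^ n / n ! := by gcongr; exact ht.1; exact ht.2
      _ = K * ((K * T) ^ n / n !) := by rw [mul_pow]; ring
  intro t ht
  have ht0 : 0 ≤ t := ht
  have h := (hT (t + 1) (by linarith)).continuousWithinAt (show t ∈ Icc 0 (t + 1) from ⟨ht0, by linarith⟩)
  refine h.mono_of_mem_nhdsWithin ?_
  have h' : Ici (0 : ℝ) ∩ Iic (t + 1) ∈ 𝓝[Ici 0] t := inter_mem_nhdsWithin _ (Iic_mem_nhds (by linarith))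
  exact Filter.mem_of_superset h' fun u hu => ⟨hu.1, hu.2⟩

/-- Pointwise summability with the exponential bound `‖Σ aₙ(t)‖ ≤ K e^{Kt}` on `t ≥ 0`.
[cite: GripenbergLondenStaffans1990, Ch. 2 Thm 3.1 (proof)] -/
theorem norm_tsum_neumannTerm_le {K : ℝ} (hK : ∀ t, 0 ≤ t → ‖k t‖ ≤ K) {t : ℝ} (ht : 0 ≤ t) :
    Summable (fun n => neumannTerm k n t) ∧ ‖∑' n, neumannTerm k n t‖ ≤ K * Real.exp (K * t) := by
  have hsum : HasSum (fun n : ℕ => K * ((K * t) ^ n / n !)) (K * Real.exp (K * t)) := by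
    have h := NormedSpace.expSeries_div_hasSum_exp (K * t)
    rw [← Real.exp_eq_exp_ℝ] at h
    exact h.mul_left K
  have hle : ∀ n, ‖neumannTerm k n t‖ ≤ K * ((K * t) ^ n / n !) := fun n => by
    calc ‖neumannTerm k n t‖ ≤ K ^ (n + 1) * t ^ n / n ! := norm_neumannTerm_le hK n t ht
      _ = K * ((K * t) ^ n / n !) := by rw [mul_pow]; ring
  exact ⟨.of_norm_bounded hsum.summable hle, tsum_of_norm_bounded hsum hle⟩

/-- The Neumann sum solves the resolvent equation on `[0, ∞)`: `Σₙ aₙ = k + k ⋆ Σₙ aₙ` (termwise integration, dominated by the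
factorial bounds). [cite: GripenbergLondenStaffans1990, Ch. 2 Thm 3.1] -/
theorem tsum_neumannTerm_eq (hk : Continuous k) {K : ℝ} (hK : ∀ t, 0 ≤ t → ‖k t‖ ≤ K) {t : ℝ} (ht : 0 ≤ t) :
    ∑' n, neumannTerm k n t = k t + hconv k (fun u => ∑' n, neumannTerm k n u) t := by
  have hK0 : 0 ≤ K := (norm_nonneg _).trans (hK 0 le_rfl)
  have hs := (norm_tsum_neumannTerm_le hK ht).1
  rw [hs.tsum_eq_zero_add]
  congr 1
  -- `Σₙ a_{n+1}(t) = Σₙ ∫₀ᵗ k(t−u) aₙ(u) du = ∫₀ᵗ k(t−u) Σₙ aₙ(u) du`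
  rw [hconv]
  have hterm : ∀ n, neumannTerm k (n + 1) t = ∫ u in (0 : ℝ)..t, k (t - u) * neumannTerm k n u := fun n => rfl
  simp_rw [hterm]
  have key := intervalIntegral.hasSum_integral_of_dominated_convergence (μ := volume) (a := 0) (b := t)
    (F := fun n u => k (t - u) * neumannTerm k n u) (f := fun u => k (t - u) * ∑' n, neumannTerm k n u)
    (fun n _ => K * (K * ((K * t) ^ n / n !)))
    (fun n => (((hk.comp (continuous_const.sub continuous_id)).mul (continuous_neumannTerm hk n)).aestronglyMeasurable))
    (fun n => Eventually.of_forall fun u hu => by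
      rw [uIoc_of_le ht] at hu
      rw [norm_mul]
      refine mul_le_mul (hK _ (by linarith [hu.2])) ?_ (norm_nonneg _) hK0
      calc ‖neumannTerm k n u‖ ≤ K ^ (n + 1) * u ^ n / n ! := norm_neumannTerm_le hK n u hu.1.le
        _ ≤ K ^ (n + 1) * t ^ n / n ! := by gcongr; exact hu.1.le; exact hu.2
        _ = K * ((K * t) ^ n / n !) := by rw [mul_pow]; ring)
    (Eventually.of_forall fun u _ => ((Real.summable_pow_div_factorial (K * t)).mul_left K).mul_left K)
    intervalIntegrable_const
    (Eventually.of_forall fun u hu => by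
      rw [uIoc_of_le ht] at hu
      exact ((norm_tsum_neumannTerm_le hK hu.1.le).1.hasSum).mul_left (k (t - u)))
  exact key.tsum_eq

/-- **Existence of the resolvent** of a continuous renewal kernel bounded on `[0,∞)`: a continuous `r` with
`r = k + k ⋆ r` on `[0,∞)` and `‖r(t)‖ ≤ K e^{Kt}` there. (The sum is extended to `t < 0` by its value at `0`, which is immaterial.)
[cite: GripenbergLondenStaffans1990, Ch. 2 Thm 3.1] -/
theorem exists_resolvent (hk : Continuous k) {K : ℝ} (hK : ∀ t, 0 ≤ t → ‖k t‖ ≤ K) :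
    ∃ r : ℝ → ℂ, Continuous r ∧ (∀ t, 0 ≤ t → r t = k t + hconv k r t) ∧
      ∀ t, 0 ≤ t → ‖r t‖ ≤ K * Real.exp (K * t) := by
  set r : ℝ → ℂ := fun t => ∑' n, neumannTerm k n (max t 0) with hr
  have hr_eq : ∀ t, 0 ≤ t → r t = ∑' n, neumannTerm k n t := fun t ht => by
    simp only [hr, max_eq_left ht]
  refine ⟨r, ?_, fun t ht => ?_, fun t ht => ?_⟩
  · exact (continuousOn_tsum_neumannTerm hk hK).comp_continuous (continuous_id.max continuous_const)
      fun t => mem_Ici.2 (le_max_right _ _)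
  · rw [hr_eq t ht, tsum_neumannTerm_eq hk hK ht]
    congr 1
    exact hconv_congr ht (fun u _ => rfl) fun u hu => (hr_eq u hu.1).symm
  · rw [hr_eq t ht]; exact (norm_tsum_neumannTerm_le hK ht).2

/-! ### Variation of constants -/

/-- **Variation-of-constants formula.** Let `k, r, m` be continuous, `m₀` any function, `r = k + k ⋆ r` on `[0,∞)` (a resolvent of `k`) and
`m = m₀ + k ⋆ m` on `[0,∞)` (a solution of the renewal equation). Then `m = m₀ + r ⋆ m₀` on `[0,∞)`.
Proof: `r ⋆ m₀ = r ⋆ (m − k ⋆ m) = r ⋆ m − (r ⋆ k) ⋆ m = (r − k ⋆ r) ⋆ m = k ⋆ m = m − m₀`.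
[cite: GripenbergLondenStaffans1990, Ch. 2 Thm 3.5 (variation of constants formula)] -/
theorem renewal_solution_eq {r m₀ m : ℝ → ℂ} (hk : Continuous k) (hr : Continuous r) (hm : Continuous m) (hres : ∀ t, 0 ≤ t → r t = k t + hconv k r t)
    (hren : ∀ t, 0 ≤ t → m t = m₀ t + hconv k m t) {t : ℝ} (ht : 0 ≤ t) :
    m t = m₀ t + hconv r m₀ t := by
  have h1 : hconv r m₀ t = hconv r (fun u => m u - hconv k m u) t :=
    hconv_congr ht (fun u _ => rfl) fun u hu => by rw [hren u hu.1]; ring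
  have h2 : hconv r (fun u => m u - hconv k m u) t = hconv r m t - hconv r (hconv k m) t :=
    hconv_sub_right hr hm (continuous_hconv hk hm) t
  have h3 : hconv r (hconv k m) t = hconv (hconv r k) m t := (hconv_assoc hr hk hm ht).symm
  have h4 : hconv (hconv r k) m t = hconv (hconv k r) m t := by
    rw [show hconv r k = hconv k r from funext fun u => hconv_comm r k u]
  have h5 : hconv r m t - hconv (hconv k r) m t = hconv (fun u => r u - hconv k r u) m t :=
    (hconv_sub_left hr (continuous_hconv hk hr) hm t).symm
  have h6 : hconv (fun u => r u - hconv k r u) m t = hconv k m t :=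
    hconv_congr ht (fun u hu => by rw [hres u hu.1]; ring) fun u _ => rfl
  have h7 : hconv k m t = m t - m₀ t := by rw [hren t ht]; ring
  rw [h1, h2, h3, h4, h5, h6, h7]; ring

end Literature.Analysis.Convolution
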